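import Summits.QuantumFields.YangMills.Theorems.UnitScaleTiltProp7V0CurrentCentralLettersT3
import Summits.QuantumFields.YangMills.Theorems.UnitScaleTiltProp7SectET3JcurReality
import Summits.QuantumFields.YangMills.Theorems.UnitScaleTiltProp7WilsonHessianSectorRows
import Literature.MathematicalPhysics.QuantumFieldTheory.Balaban1983to89.B11Eq92CommutatorFunctional
import Literature.Analysis.Matrix.DetExp
import HarnessLib

/-!
# (R-V₀) brick V2b — THE ONE-BOND FUNCTIONAL OF `V′₀` KILLS THE CENTRE: `((∂/∂A(b))V′₀)(A, ∂q)·(c·1) = 0`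

Route `UnitScaleTilt`, crux EX `MinimiserStabilityRegPr` (stmt-QuantumFields-19200), display of record S13ᴰ, row `hV0` (the `V′₀`-current of (90) is `S`-valued,
`S` = Hermitian traceless data); the CALCULUS half of the located plan (evidence `LOCATE-RV0-px3g3.md` §3(β)).  Along a CENTRAL line `A + s·(d·1)` every
plaquette functional `s ↦ V′₀(A + s·(d·1), ∂p)` of [Balaban1985Variational, (39) p.284] is EVEN in `s`, so its derivative at `0` vanishes; in particular the
one-bond functionals (63)/(90) `dV0primeBond … (c·1)` and (91)–(93) `dTerm39Bond … (c·1)` are `0`.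
Mechanism ([Balaban1985BackgroundPropagators, (3.2)–(3.7) pp.390–391] along a central line; cf. ✓`Prop7WilsonHessianSectorRows` §3–§5 for the Wilson action):
the four transported letters shift by central scalars (✓`Prop7V0CurrentCentralLetters.lettersA_add_smul_one`), the commutator sums do not move, the plaquette
variable `P = Π e^{iηA′}·U₀(∂p)` picks up the phase `e^{iηsα}` (`α` = signed sum of `d` around `∂p`), `X = η⁻¹ΣA′` shifts by `η⁻¹sα·1`; by the exact insertion
formula ✓`B9Eq37Insertion.eq37_summand`, `rem3` (so `V₀ = η⁻⁴rem3`) is `τ1 − ½(e^{iηsα}τP + e^{−iηsα}τP⁻¹) − wil W − η²τ((X + sc·1)Im W) − ½η⁴τ((X + sc·1)²Re W)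
− ½η²τ(iC·Im W)`, EVEN in `s` once `τP⁻¹ = τP`, `τ(Im W) = 0`, `τ(X·Re W) = 0` — true for `τ = tr` on `M₂(ℂ)` at a determinant-one reading and a traceless
field (`P⁻¹ = adj P`, `W + W⁻¹ = (tr W)·1`); the (39)-term is even CONSTANT along the line (`tr comm2 = 0`).
§1 generic `𝔸`, tracial `τ`: the central line, `term39` constant, closed form ∕ evenness of `rem3`, `V′₀`, the generic vanishing theorems.  §2 `M₂(ℂ)`, `τ = tr`,
`det U₀(b) = 1`, `tr A = 0`: the three facts, ★`dV0primeBond_apply_smul_one_eq_zero`, ★`deriv_V0primeP_central_eq_zero_M2` (+ §1 ★`dTerm39Bond_apply_smul_one_eq_zero`).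
Lit-balaban's own letters throughout; nothing restated.  Helper toward stmt-QuantumFields-19200 (`--supports`), def-free, sorry-free.
-/

noncomputable section

open NormedSpace Complex

namespace Summit.QuantumFields.YangMills.Theorems.Prop7V0CurrentCentralDeriv

open Literature.MathematicalPhysics.QuantumFieldTheory.Balaban1983to89
open Literature.MathematicalPhysics.QuantumFieldTheory.Balaban1983to89.Beta.TransportVertices (holonomy commSum commSum_four)
open B9Eq39Adjoint (R R_def R_add R_smul R_apply_one lettersA sum_lettersA plaqU curl curlη rem3)
open Literature.MathematicalPhysics.QuantumFieldTheory.Balaban1983to89.Beta.AdjointTransportJets (invPath)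
open B9Eq37Insertion (letters plaqD holU val_holU reC imC wil rem eq37_summand)
open B11Eq26ActionExpansion (V0p)
open B11Eq90StB (bondDelta)
open B11Eq90V0primeBond (term39 V0primeP dV0primeBond dV0primeBond_apply contDiff_V0primeP)
open B11Eq92CommutatorFunctional (dTerm39Bond dTerm39Bond_apply)
open Summit.QuantumFields.YangMills.Theorems.Prop7V0CurrentCentralLetters (lettersA_add_smul_one commSum_add_central_four comm2_add_central
  holonomy_letters_add_smul_one_four)

/-! ## §1 Generic: the central line `s ↦ A + s·(d·1)` -/

section Generic

variable {𝔸 : Type*} [NormedRing 𝔸] [NormedAlgebra ℂ 𝔸] [CompleteSpace 𝔸]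
variable {S : Type*} {ι : Type*} (T : ι → Equiv.Perm S) (U : ι → S → 𝔸ˣ)

omit [CompleteSpace 𝔸] in
/-- The central line re-read as a scalar field: `A + s·(d·1) = A + (s·d)·1`. [folklore] -/
theorem add_smul_central (A : ι → S → 𝔸) (d : ι → S → ℂ) (s : ℂ) :
    A + s • (fun κ y => d κ y • (1 : 𝔸)) = A + fun κ y => (s * d κ y) • (1 : 𝔸) := by
  congr 1
  funext κ y
  simp only [Pi.smul_apply, smul_smul]

omit [CompleteSpace 𝔸] in
/-- A central scalar commutes with everything. [folklore] -/
theorem commute_smul_one (c : ℂ) (X : 𝔸) : Commute (c • (1 : 𝔸)) X :=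
  (Commute.one_left X).smul_left c

omit [CompleteSpace 𝔸] in
/-- **THE FOUR LETTERS ALONG THE CENTRAL LINE**: `A′ₖ(A + s·d·1) = A′ₖ(A) + s·eₖ·1`, `(eₖ) = (−d_μ(x+e_ν), −d_ν(x), d_μ(x), d_ν(x+e_μ))`. [cite: Balaban1985BackgroundPropagators, (3.5) p.391] -/
theorem lettersA_add_smul_central (A : ι → S → 𝔸) (d : ι → S → ℂ) (s : ℂ) (μ ν : ι) (x : S) :
    lettersA T U (A + s • fun κ y => d κ y • (1 : 𝔸)) μ ν x =
      [-(R (U ν x) (A μ (T ν x))) + (-(s * d μ (T ν x))) • (1 : 𝔸), -(A ν x) + (-(s * d ν x)) • (1 : 𝔸), A μ x + (s * d μ x) • (1 : 𝔸),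
        R (U μ x) (A ν (T μ x)) + (s * d ν (T μ x)) • (1 : 𝔸)] := by
  rw [add_smul_central, lettersA_add_smul_one]

omit [CompleteSpace 𝔸] in
/-- **THE LETTER SUM SHIFTS CENTRALLY**: `Σₖ A′ₖ(A + s·d·1) = Σₖ A′ₖ(A) + s·α·1`, `α` = the signed sum of `d` around `∂p`. [cite: Balaban1985BackgroundPropagators, (3.4) p.391] -/
theorem sum_lettersA_add_smul_central (A : ι → S → 𝔸) (d : ι → S → ℂ) (s : ℂ) (μ ν : ι) (x : S) :
    (lettersA T U (A + s • fun κ y => d κ y • (1 : 𝔸)) μ ν x).sum =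
      (lettersA T U A μ ν x).sum + (s * (-d μ (T ν x) - d ν x + d μ x + d ν (T μ x))) • (1 : 𝔸) := by
  rw [lettersA_add_smul_central]
  have hs : (s * (-d μ (T ν x) - d ν x + d μ x + d ν (T μ x))) • (1 : 𝔸) =
      (-(s * d μ (T ν x))) • (1 : 𝔸) + (-(s * d ν x)) • (1 : 𝔸) + (s * d μ x) • (1 : 𝔸) + (s * d ν (T μ x)) • (1 : 𝔸) := by
    simp only [← add_smul]
    congr 1
    ring
  rw [hs]
  simp only [lettersA, List.sum_cons, List.sum_nil]
  abel

omit [CompleteSpace 𝔸] in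
/-- **`X = η⁻¹ΣA′` SHIFTS CENTRALLY**: `X(A + s·d·1) = X(A) + η⁻¹sα·1`. [cite: Balaban1985BackgroundPropagators, (3.4) p.391] -/
theorem plaqD_lettersA_add_smul_central (η : ℝ) (A : ι → S → 𝔸) (d : ι → S → ℂ) (s : ℂ) (μ ν : ι) (x : S) :
    plaqD η (lettersA T U (A + s • fun κ y => d κ y • (1 : 𝔸)) μ ν x) =
      plaqD η (lettersA T U A μ ν x) + ((η : ℂ)⁻¹ * (s * (-d μ (T ν x) - d ν x + d μ x + d ν (T μ x)))) • (1 : 𝔸) := by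
  rw [plaqD, plaqD, sum_lettersA_add_smul_central, smul_add, smul_smul]

omit [CompleteSpace 𝔸] in
/-- **THE COVARIANT CURL SHIFTS CENTRALLY**: `(D^ηA)(p)(A + s·d·1) = (D^ηA)(p) + η⁻¹sα·1`. [cite: Balaban1985BackgroundPropagators, (3.4) p.391] -/
theorem curlη_add_smul_central (η : ℝ) (A : ι → S → 𝔸) (d : ι → S → ℂ) (s : ℂ) (μ ν : ι) (x : S) :
    curlη T U η (A + s • fun κ y => d κ y • (1 : 𝔸)) μ ν x =
      curlη T U η A μ ν x + ((η : ℂ)⁻¹ * (s * (-d μ (T ν x) - d ν x + d μ x + d ν (T μ x)))) • (1 : 𝔸) := by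
  rw [curlη, curlη, ← sum_lettersA, ← sum_lettersA, sum_lettersA_add_smul_central, smul_add, smul_smul]

omit [NormedAlgebra ℂ 𝔸] [CompleteSpace 𝔸] in
/-- The letter list of `A` spelled out. [cite: Balaban1985BackgroundPropagators, (3.5) p.391] -/
theorem lettersA_eq (A : ι → S → 𝔸) (μ ν : ι) (x : S) :
    lettersA T U A μ ν x = [-(R (U ν x) (A μ (T ν x))), -(A ν x), A μ x, R (U μ x) (A ν (T μ x))] := rfl

omit [CompleteSpace 𝔸] in
/-- **THE ORDERED COMMUTATOR SUM DOES NOT MOVE** along the central line. [cite: Balaban1985BackgroundPropagators, (3.6) p.391] -/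
theorem commSum_lettersA_add_smul_central (A : ι → S → 𝔸) (d : ι → S → ℂ) (s : ℂ) (μ ν : ι) (x : S) :
    commSum (lettersA T U (A + s • fun κ y => d κ y • (1 : 𝔸)) μ ν x) = commSum (lettersA T U A μ ν x) := by
  rw [lettersA_add_smul_central, lettersA_eq]
  exact commSum_add_central_four _ _ _ _ _ _ _ _ (commute_smul_one _) (commute_smul_one _) (commute_smul_one _) (commute_smul_one _)

omit [CompleteSpace 𝔸] in
/-- **`comm2` OF THE FOUR LETTERS DOES NOT MOVE** along the central line (letters spelled as inside `B11Eq90V0primeBond.term39`). [cite: Balaban1985Variational, (39) p.284] -/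
theorem comm2_lettersA_add_smul_central (A : ι → S → 𝔸) (d : ι → S → ℂ) (s : ℂ) (μ ν : ι) (x : S) :
    B11Eq34BCH.comm2 (-(R (U ν x) ((A + s • fun κ y => d κ y • (1 : 𝔸)) μ (T ν x)))) (-((A + s • fun κ y => d κ y • (1 : 𝔸)) ν x))
        ((A + s • fun κ y => d κ y • (1 : 𝔸)) μ x) (R (U μ x) ((A + s • fun κ y => d κ y • (1 : 𝔸)) ν (T μ x)))
      = B11Eq34BCH.comm2 (-(R (U ν x) (A μ (T ν x)))) (-(A ν x)) (A μ x) (R (U μ x) (A ν (T μ x))) := by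
  have hl := lettersA_add_smul_central T U A d s μ ν x
  simp only [lettersA, List.cons.injEq, and_true] at hl
  obtain ⟨h0, h1, h2, h3⟩ := hl
  rw [h0, h1, h2, h3]
  exact comm2_add_central _ _ _ _ _ _ _ _ (commute_smul_one _) (commute_smul_one _) (commute_smul_one _) (commute_smul_one _)

omit [CompleteSpace 𝔸] in
/-- A tracial functional kills `comm2` (six commutators). [folklore] -/
theorem apply_comm2_eq_zero (τ : 𝔸 →ₗ[ℂ] ℂ) (hτ : ∀ a b : 𝔸, τ (a * b) = τ (b * a)) (Y₁ Y₂ Y₃ Y₄ : 𝔸) :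
    τ (B11Eq34BCH.comm2 Y₁ Y₂ Y₃ Y₄) = 0 := by
  have hc : ∀ a b : 𝔸, τ ⁅a, b⁆ = 0 := fun a b => by rw [Ring.lie_def, map_sub, hτ, sub_self]
  simp only [B11Eq34BCH.comm2, map_add, hc, add_zero]

variable [Fintype S] [Fintype ι] [LinearOrder ι]

omit [CompleteSpace 𝔸] [Fintype S] [Fintype ι] [LinearOrder ι] in
/-- ★ **THE (39)-TERM IS CONSTANT ALONG A CENTRAL LINE**: `term39(A + s·d·1, ∂p) = term39(A, ∂p)` for a tracial `τ` (the commutators do not move, the curl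
moves by a central scalar, and `τ(comm2) = 0`). [cite: Balaban1985Variational, (39) p.284] -/
theorem term39_add_smul_central (τ : 𝔸 →ₗ[ℂ] ℂ) (hτ : ∀ a b : 𝔸, τ (a * b) = τ (b * a)) (η : ℝ) (A : ι → S → 𝔸) (d : ι → S → ℂ) (s : ℂ)
    (μ ν : ι) (x : S) :
    term39 T U η τ (A + s • fun κ y => d κ y • (1 : 𝔸)) μ ν x = term39 T U η τ A μ ν x := by
  unfold term39
  rw [comm2_lettersA_add_smul_central, curlη_add_smul_central, add_mul, map_add, smul_mul_assoc, one_mul, map_smul,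
    apply_comm2_eq_zero τ hτ, smul_zero, add_zero]

omit [Fintype S] [Fintype ι] [LinearOrder ι] in
/-- **THE PLAQUETTE VARIABLE PICKS UP A PHASE**: `Π e^{iηA′ₖ(A + s·d·1)} = e^{iηsα}·Π e^{iηA′ₖ(A)}`. [cite: Balaban1985BackgroundPropagators, (3.2)–(3.3) p.390] -/
theorem val_holU_lettersA_add_smul_central (η : ℝ) (A : ι → S → 𝔸) (d : ι → S → ℂ) (s : ℂ) (μ ν : ι) (x : S) :
    ((holU (letters η (lettersA T U (A + s • fun κ y => d κ y • (1 : 𝔸)) μ ν x)) : 𝔸ˣ) : 𝔸)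
      = Complex.exp (I * η * (s * (-d μ (T ν x) - d ν x + d μ x + d ν (T μ x)))) •
          ((holU (letters η (lettersA T U A μ ν x)) : 𝔸ˣ) : 𝔸) := by
  rw [val_holU, val_holU, lettersA_add_smul_central, lettersA_eq, holonomy_letters_add_smul_one_four]
  congr 2
  ring

omit [CompleteSpace 𝔸] [Fintype S] [Fintype ι] [LinearOrder ι] in
/-- If a unit is a scalar phase times another unit, so is its inverse: `u = e^{z}·P ⟹ u⁻¹ = e^{−z}·P⁻¹`. [folklore] -/
theorem val_inv_of_val_eq_exp_smul {u P : 𝔸ˣ} {z : ℂ} (hu : (u : 𝔸) = Complex.exp z • (P : 𝔸)) :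
    ((u⁻¹ : 𝔸ˣ) : 𝔸) = Complex.exp (-z) • ((P⁻¹ : 𝔸ˣ) : 𝔸) := by
  apply Units.inv_eq_of_mul_eq_one_right
  rw [hu, smul_mul_assoc, mul_smul_comm, smul_smul, Units.mul_inv, ← Complex.exp_add, add_neg_cancel, Complex.exp_zero, one_smul]

omit [Fintype S] [Fintype ι] [LinearOrder ι] in
/-- **`Re` OF THE SHIFTED PLAQUETTE VARIABLE**: `Re(Π e^{iηA′ₖ(A + s·d·1)}·W) = ½(e^{iηsα}P + e^{−iηsα}P⁻¹)`, `P = Π e^{iηA′ₖ(A)}·W`. [cite: Balaban1985BackgroundPropagators, (3.7) p.391] -/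
theorem reC_holU_lettersA_add_smul_central (η : ℝ) (A : ι → S → 𝔸) (d : ι → S → ℂ) (s : ℂ) (μ ν : ι) (x : S) (W : 𝔸ˣ) :
    reC (holU (letters η (lettersA T U (A + s • fun κ y => d κ y • (1 : 𝔸)) μ ν x)) * W)
      = (2 : ℂ)⁻¹ • (Complex.exp (I * η * (s * (-d μ (T ν x) - d ν x + d μ x + d ν (T μ x)))) •
            ((holU (letters η (lettersA T U A μ ν x)) * W : 𝔸ˣ) : 𝔸)
          + Complex.exp (-(I * η * (s * (-d μ (T ν x) - d ν x + d μ x + d ν (T μ x))))) •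
            (((holU (letters η (lettersA T U A μ ν x)) * W)⁻¹ : 𝔸ˣ) : 𝔸)) := by
  have hu : ((holU (letters η (lettersA T U (A + s • fun κ y => d κ y • (1 : 𝔸)) μ ν x)) * W : 𝔸ˣ) : 𝔸)
      = Complex.exp (I * η * (s * (-d μ (T ν x) - d ν x + d μ x + d ν (T μ x)))) •
          ((holU (letters η (lettersA T U A μ ν x)) * W : 𝔸ˣ) : 𝔸) := by
    rw [Units.val_mul, Units.val_mul, val_holU_lettersA_add_smul_central, smul_mul_assoc]
  rw [reC, hu, val_inv_of_val_eq_exp_smul hu]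

omit [Fintype S] [Fintype ι] [LinearOrder ι] in
/-- ★ **THE REMAINDER FUNCTIONAL ALONG A CENTRAL LINE, CLOSED FORM** (from the exact insertion formula ✓`eq37_summand`): with `l = (A′ₖ(A))ₖ`, `W = U₀(∂p)`,
`P = Π e^{iηA′ₖ}·W`, `X = η⁻¹Σ A′ₖ`, `C = Σ_{j<k}[A′_j, A′_k]`, `c = η⁻¹sα`,
`rem3(A + s·d·1) = τ1 − ½(e^{iηsα}τP + e^{−iηsα}τP⁻¹) − wil W − η²τ((X + c·1)Im W) − ½η⁴τ((X + c·1)²Re W) − ½η²τ(iC·Im W)`.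
[cite: Balaban1985BackgroundPropagators, (3.7) p.391] -/
theorem rem3_add_smul_central (τ : 𝔸 →ₗ[ℂ] ℂ) (hτ : ∀ a b : 𝔸, τ (a * b) = τ (b * a)) (η : ℝ) (A : ι → S → 𝔸) (d : ι → S → ℂ) (s : ℂ)
    (μ ν : ι) (x : S) :
    rem3 T U η τ (A + s • fun κ y => d κ y • (1 : 𝔸)) μ ν x =
      τ 1 - 2⁻¹ * (Complex.exp (I * η * (s * (-d μ (T ν x) - d ν x + d μ x + d ν (T μ x)))) *
              τ ((holU (letters η (lettersA T U A μ ν x)) * plaqU T U μ ν x : 𝔸ˣ) : 𝔸)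
            + Complex.exp (-(I * η * (s * (-d μ (T ν x) - d ν x + d μ x + d ν (T μ x))))) *
              τ (((holU (letters η (lettersA T U A μ ν x)) * plaqU T U μ ν x)⁻¹ : 𝔸ˣ) : 𝔸))
        - wil τ (plaqU T U μ ν x)
        - (η : ℂ) ^ 2 * τ ((plaqD η (lettersA T U A μ ν x)
            + ((η : ℂ)⁻¹ * (s * (-d μ (T ν x) - d ν x + d μ x + d ν (T μ x)))) • (1 : 𝔸)) * imC (plaqU T U μ ν x))
        - 2⁻¹ * (η : ℂ) ^ 4 * τ ((plaqD η (lettersA T U A μ ν x)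
            + ((η : ℂ)⁻¹ * (s * (-d μ (T ν x) - d ν x + d μ x + d ν (T μ x)))) • (1 : 𝔸))
            * (plaqD η (lettersA T U A μ ν x)
              + ((η : ℂ)⁻¹ * (s * (-d μ (T ν x) - d ν x + d μ x + d ν (T μ x)))) • (1 : 𝔸)) * reC (plaqU T U μ ν x))
        - 2⁻¹ * (η : ℂ) ^ 2 * τ ((I • commSum (lettersA T U A μ ν x)) * imC (plaqU T U μ ν x)) := by
  have h37 := eq37_summand τ hτ η (lettersA T U (A + s • fun κ y => d κ y • (1 : 𝔸)) μ ν x) (plaqU T U μ ν x)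
  have hrem : rem3 T U η τ (A + s • fun κ y => d κ y • (1 : 𝔸)) μ ν x =
      -(2 : ℂ)⁻¹ * (τ (rem (letters η (lettersA T U (A + s • fun κ y => d κ y • (1 : 𝔸)) μ ν x)) * (plaqU T U μ ν x : 𝔸))
        + τ ((((plaqU T U μ ν x)⁻¹ : 𝔸ˣ) : 𝔸) * rem (invPath (letters η (lettersA T U (A + s • fun κ y => d κ y • (1 : 𝔸)) μ ν x))))) := rfl
  have hwil : wil τ (holU (letters η (lettersA T U (A + s • fun κ y => d κ y • (1 : 𝔸)) μ ν x)) * plaqU T U μ ν x)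
      = τ 1 - 2⁻¹ * (Complex.exp (I * η * (s * (-d μ (T ν x) - d ν x + d μ x + d ν (T μ x)))) *
              τ ((holU (letters η (lettersA T U A μ ν x)) * plaqU T U μ ν x : 𝔸ˣ) : 𝔸)
            + Complex.exp (-(I * η * (s * (-d μ (T ν x) - d ν x + d μ x + d ν (T μ x))))) *
              τ (((holU (letters η (lettersA T U A μ ν x)) * plaqU T U μ ν x)⁻¹ : 𝔸ˣ) : 𝔸)) := by
    rw [wil, reC_holU_lettersA_add_smul_central, map_smul, map_add, map_smul, map_smul, smul_eq_mul, smul_eq_mul, smul_eq_mul]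
  rw [hrem, ← hwil, ← plaqD_lettersA_add_smul_central, ← commSum_lettersA_add_smul_central T U A d s μ ν x]
  linear_combination -h37

omit [Fintype S] [Fintype ι] [LinearOrder ι] in
/-- ★ **`rem3` IS EVEN ALONG A CENTRAL LINE** as soon as `τP⁻¹ = τP`, `τ(Im W) = 0` and `τ(X·Re W) = 0` (`P = Π e^{iηA′ₖ}·W`, `W = U₀(∂p)`, `X = η⁻¹ΣA′ₖ`).
[cite: Balaban1985BackgroundPropagators, (3.7) p.391] -/
theorem rem3_add_neg_smul_central (τ : 𝔸 →ₗ[ℂ] ℂ) (hτ : ∀ a b : 𝔸, τ (a * b) = τ (b * a)) (η : ℝ) (A : ι → S → 𝔸) (d : ι → S → ℂ)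
    (μ ν : ι) (x : S)
    (hP : τ (((holU (letters η (lettersA T U A μ ν x)) * plaqU T U μ ν x)⁻¹ : 𝔸ˣ) : 𝔸)
      = τ ((holU (letters η (lettersA T U A μ ν x)) * plaqU T U μ ν x : 𝔸ˣ) : 𝔸))
    (himC : τ (imC (plaqU T U μ ν x)) = 0) (hXre : τ (plaqD η (lettersA T U A μ ν x) * reC (plaqU T U μ ν x)) = 0) (s : ℂ) :
    rem3 T U η τ (A + (-s) • fun κ y => d κ y • (1 : 𝔸)) μ ν x = rem3 T U η τ (A + s • fun κ y => d κ y • (1 : 𝔸)) μ ν x := by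
  rw [rem3_add_smul_central T U τ hτ, rem3_add_smul_central T U τ hτ, hP]
  have e1 : Complex.exp (I * η * (-s * (-d μ (T ν x) - d ν x + d μ x + d ν (T μ x))))
      = Complex.exp (-(I * η * (s * (-d μ (T ν x) - d ν x + d μ x + d ν (T μ x))))) := by
    congr 1; ring
  have e2 : Complex.exp (-(I * η * (-s * (-d μ (T ν x) - d ν x + d μ x + d ν (T μ x)))))
      = Complex.exp (I * η * (s * (-d μ (T ν x) - d ν x + d μ x + d ν (T μ x)))) := by
    congr 1; ring
  rw [e1, e2]
  simp only [add_mul, mul_add, smul_mul_assoc, mul_smul_comm, one_mul, mul_one, map_add, map_smul, smul_eq_mul, himC, hXre,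
    mul_zero, add_zero]
  ring

omit [Fintype S] [Fintype ι] [LinearOrder ι] in
/-- ★ **`V′₀(·, ∂p)` IS EVEN ALONG A CENTRAL LINE** (same three facts; the (39)-term is constant). [cite: Balaban1985Variational, (39) p.284] -/
theorem V0primeP_add_neg_smul_central (τ : 𝔸 →ₗ[ℂ] ℂ) (hτ : ∀ a b : 𝔸, τ (a * b) = τ (b * a)) (η : ℝ) (A : ι → S → 𝔸) (d : ι → S → ℂ)
    (μ ν : ι) (x : S)
    (hP : τ (((holU (letters η (lettersA T U A μ ν x)) * plaqU T U μ ν x)⁻¹ : 𝔸ˣ) : 𝔸)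
      = τ ((holU (letters η (lettersA T U A μ ν x)) * plaqU T U μ ν x : 𝔸ˣ) : 𝔸))
    (himC : τ (imC (plaqU T U μ ν x)) = 0) (hXre : τ (plaqD η (lettersA T U A μ ν x) * reC (plaqU T U μ ν x)) = 0) (s : ℂ) :
    V0primeP T U η τ (A + (-s) • fun κ y => d κ y • (1 : 𝔸)) μ ν x = V0primeP T U η τ (A + s • fun κ y => d κ y • (1 : 𝔸)) μ ν x := by
  unfold V0primeP V0p
  rw [rem3_add_neg_smul_central T U τ hτ η A d μ ν x hP himC hXre s, term39_add_smul_central T U τ hτ, term39_add_smul_central T U τ hτ]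

omit [Fintype S] [Fintype ι] [LinearOrder ι] in
/-- An even function of one complex variable, differentiable at `0`, has derivative `0` there. [folklore] -/
theorem deriv_eq_zero_of_even {f : ℂ → ℂ} (hf : DifferentiableAt ℂ f 0) (heven : ∀ s, f (-s) = f s) : deriv f 0 = 0 := by
  have h1 : HasDerivAt f (deriv f 0) 0 := hf.hasDerivAt
  have hneg : HasDerivAt (fun s : ℂ => -s) (-1) 0 := by simpa using hasDerivAt_neg (0 : ℂ)
  have h1' : HasDerivAt f (deriv f 0) (-0) := by rw [neg_zero]; exact h1
  have h2 : HasDerivAt (fun s : ℂ => f (-s)) (deriv f 0 * (-1)) 0 := h1'.comp (0 : ℂ) hneg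
  have heq : (fun s : ℂ => f (-s)) = f := funext heven
  rw [heq] at h2
  have h := h1.unique h2
  have h2' : (2 : ℂ) * deriv f 0 = 0 := by linear_combination h
  exact (mul_eq_zero.1 h2').resolve_left two_ne_zero

omit [LinearOrder ι] in
/-- ★ **THE LINE DERIVATIVE OF `V′₀(·, ∂p)` ALONG A CENTRAL DIRECTION VANISHES** under the three facts. [cite: Balaban1985Variational, (39) p.284, (63) p.287] -/
theorem deriv_V0primeP_central_eq_zero (τ : 𝔸 →L[ℂ] ℂ) (hτ : ∀ a b : 𝔸, τ (a * b) = τ (b * a)) (η : ℝ) (A : ι → S → 𝔸) (d : ι → S → ℂ)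
    (μ ν : ι) (x : S)
    (hP : τ (((holU (letters η (lettersA T U A μ ν x)) * plaqU T U μ ν x)⁻¹ : 𝔸ˣ) : 𝔸)
      = τ ((holU (letters η (lettersA T U A μ ν x)) * plaqU T U μ ν x : 𝔸ˣ) : 𝔸))
    (himC : τ (imC (plaqU T U μ ν x)) = 0) (hXre : τ (plaqD η (lettersA T U A μ ν x) * reC (plaqU T U μ ν x)) = 0) :
    deriv (fun s : ℂ => V0primeP T U η (τ : 𝔸 →ₗ[ℂ] ℂ) (A + s • fun κ y => d κ y • (1 : 𝔸)) μ ν x) 0 = 0 := by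
  refine deriv_eq_zero_of_even ?_ (fun s => V0primeP_add_neg_smul_central T U (τ : 𝔸 →ₗ[ℂ] ℂ) hτ η A d μ ν x hP himC hXre s)
  have hV := (contDiff_V0primeP T U (n := 1) η τ μ ν x).differentiable (by norm_num)
  have hline : Differentiable ℂ (fun s : ℂ => A + s • fun κ y => d κ y • (1 : 𝔸)) :=
    (differentiable_const A).add (differentiable_id.smul_const _)
  exact (hV.comp hline).differentiableAt

variable [DecidableEq S]

omit [CompleteSpace 𝔸] [Fintype S] [Fintype ι] in
/-- The one-bond variation by a central element is a central line: `δ_b(c·1) = (c·𝟙_b)·1`. [cite: Balaban1985Variational, (63) p.287] -/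
theorem bondDelta_smul_one (μ₀ : ι) (x₀ : S) (c : ℂ) :
    bondDelta μ₀ x₀ (c • (1 : 𝔸)) = fun κ y => (if κ = μ₀ ∧ y = x₀ then c else 0) • (1 : 𝔸) := by
  funext κ y
  simp only [bondDelta]
  split_ifs <;> simp

/-- ★ **THE ONE-BOND FUNCTIONAL OF `V′₀` KILLS CENTRAL VARIATIONS** (generic): `((∂/∂A(b))V′₀)(A, ∂q)·(c·1) = 0` under the three facts. [cite: Balaban1985Variational, (90) p.291] -/
theorem dV0primeBond_apply_smul_one_eq_zero_of (τ : 𝔸 →L[ℂ] ℂ) (hτ : ∀ a b : 𝔸, τ (a * b) = τ (b * a)) (η : ℝ) (A : ι → S → 𝔸)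
    (q : S × ι × ι) (μ₀ : ι) (x₀ : S) (c : ℂ)
    (hP : τ (((holU (letters η (lettersA T U A q.2.1 q.2.2 q.1)) * plaqU T U q.2.1 q.2.2 q.1)⁻¹ : 𝔸ˣ) : 𝔸)
      = τ ((holU (letters η (lettersA T U A q.2.1 q.2.2 q.1)) * plaqU T U q.2.1 q.2.2 q.1 : 𝔸ˣ) : 𝔸))
    (himC : τ (imC (plaqU T U q.2.1 q.2.2 q.1)) = 0)
    (hXre : τ (plaqD η (lettersA T U A q.2.1 q.2.2 q.1) * reC (plaqU T U q.2.1 q.2.2 q.1)) = 0) :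
    dV0primeBond T U η τ A q μ₀ x₀ (c • (1 : 𝔸)) = 0 := by
  rw [dV0primeBond_apply, bondDelta_smul_one]
  exact deriv_V0primeP_central_eq_zero T U τ hτ η A _ q.2.1 q.2.2 q.1 hP himC hXre

omit [CompleteSpace 𝔸] in
/-- ★ **THE ONE-BOND FUNCTIONAL OF THE (39)-TERM KILLS CENTRAL VARIATIONS** (any tracial `τ`, any reading). [cite: Balaban1985Variational, (91)–(93) p.292] -/
theorem dTerm39Bond_apply_smul_one_eq_zero (τ : 𝔸 →L[ℂ] ℂ) (hτ : ∀ a b : 𝔸, τ (a * b) = τ (b * a)) (η : ℝ) (A : ι → S → 𝔸)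
    (q : S × ι × ι) (μ₀ : ι) (x₀ : S) (c : ℂ) :
    dTerm39Bond T U η τ A q μ₀ x₀ (c • (1 : 𝔸)) = 0 := by
  rw [dTerm39Bond_apply, bondDelta_smul_one]
  simp_rw [term39_add_smul_central T U (τ : 𝔸 →ₗ[ℂ] ℂ) hτ]
  exact deriv_const (0 : ℂ) _

end Generic

/-! ## §2 `M₂(ℂ)`, `τ = tr`, a determinant-one reading and a traceless field: the three facts, and the vanishing theorems -/

section M2

open scoped Matrix.Norms.L2Operator

open Summit.QuantumFields.YangMills.Theorems.Prop7SectET3JcurReality (trace_R)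
open Summit.QuantumFields.YangMills.Theorems.Prop7WilsonHessianSectorRows (trace_inv_eq_trace_of_det_eq_one)

/-- **CAYLEY–HAMILTON AT `det = 1`: `W + W⁻¹ = (tr W)·1`** for a `2 × 2` unit of determinant one (`W⁻¹ = adj W`). [folklore] -/
theorem val_add_val_inv_eq_trace_smul_one (W : (Matrix (Fin 2) (Fin 2) ℂ)ˣ) (hW : ((W : (Matrix (Fin 2) (Fin 2) ℂ)ˣ) : Matrix (Fin 2) (Fin 2) ℂ).det = 1) :
    (W : Matrix (Fin 2) (Fin 2) ℂ) + ((W⁻¹ : (Matrix (Fin 2) (Fin 2) ℂ)ˣ) : Matrix (Fin 2) (Fin 2) ℂ)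
      = ((W : (Matrix (Fin 2) (Fin 2) ℂ)ˣ) : Matrix (Fin 2) (Fin 2) ℂ).trace • (1 : Matrix (Fin 2) (Fin 2) ℂ) := by
  rw [Matrix.coe_units_inv, Matrix.inv_def, hW, Ring.inverse_one, one_smul, Matrix.adjugate_fin_two, Matrix.trace_fin_two]
  ext i j
  fin_cases i <;> fin_cases j <;> simp [add_comm]

/-- **`Re W = ½(tr W)·1` IS CENTRAL** for a `2 × 2` unit of determinant one (lit's `reC W = ½(W + W⁻¹)`). [cite: Balaban1985BackgroundPropagators, (3.7) p.391] -/
theorem reC_eq_half_trace_smul_one_of_det_eq_one (W : (Matrix (Fin 2) (Fin 2) ℂ)ˣ) (hW : ((W : (Matrix (Fin 2) (Fin 2) ℂ)ˣ) : Matrix (Fin 2) (Fin 2) ℂ).det = 1) :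
    reC W = ((2 : ℂ)⁻¹ * ((W : (Matrix (Fin 2) (Fin 2) ℂ)ˣ) : Matrix (Fin 2) (Fin 2) ℂ).trace) • (1 : Matrix (Fin 2) (Fin 2) ℂ) := by
  rw [reC, val_add_val_inv_eq_trace_smul_one W hW, smul_smul]

/-- **`tr(X·Re W) = 0`** for traceless `X` and a `2 × 2` unit `W` of determinant one. [cite: Balaban1985BackgroundPropagators, (3.7) p.391] -/
theorem trace_mul_reC_eq_zero_of_det_eq_one (W : (Matrix (Fin 2) (Fin 2) ℂ)ˣ) (hW : ((W : (Matrix (Fin 2) (Fin 2) ℂ)ˣ) : Matrix (Fin 2) (Fin 2) ℂ).det = 1)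
    {X : Matrix (Fin 2) (Fin 2) ℂ} (hX : X.trace = 0) : (X * reC W).trace = 0 := by
  rw [reC_eq_half_trace_smul_one_of_det_eq_one W hW, Matrix.mul_smul, Matrix.mul_one, Matrix.trace_smul, hX, smul_zero]

/-- **`tr Im W = 0`** for a `2 × 2` unit of determinant one (`tr W⁻¹ = tr W`). [cite: Balaban1985BackgroundPropagators, (3.7) p.391] -/
theorem trace_imC_eq_zero_of_det_eq_one (W : (Matrix (Fin 2) (Fin 2) ℂ)ˣ) (hW : ((W : (Matrix (Fin 2) (Fin 2) ℂ)ˣ) : Matrix (Fin 2) (Fin 2) ℂ).det = 1) :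
    (imC W).trace = 0 := by
  rw [imC, Matrix.trace_smul, Matrix.trace_sub, trace_inv_eq_trace_of_det_eq_one W hW, sub_self, smul_zero]

/-- The inverse of a determinant-one unit has determinant one. [folklore] -/
theorem det_val_inv_eq_one (V : (Matrix (Fin 2) (Fin 2) ℂ)ˣ) (hV : ((V : (Matrix (Fin 2) (Fin 2) ℂ)ˣ) : Matrix (Fin 2) (Fin 2) ℂ).det = 1) :
    (((V⁻¹ : (Matrix (Fin 2) (Fin 2) ℂ)ˣ)) : Matrix (Fin 2) (Fin 2) ℂ).det = 1 := by
  have h := congrArg Matrix.det V.mul_inv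
  rwa [Matrix.det_mul, hV, one_mul, Matrix.det_one] at h

variable {S : Type*} {ι : Type*} (T : ι → Equiv.Perm S) (U : ι → S → (Matrix (Fin 2) (Fin 2) ℂ)ˣ)

/-- **PLAQUETTE VARIABLES OF A DETERMINANT-ONE READING HAVE DETERMINANT ONE.** [cite: Balaban1985BackgroundPropagators, (3.1) p.390] -/
theorem det_val_plaqU_eq_one (hU : ∀ μ x, ((U μ x : (Matrix (Fin 2) (Fin 2) ℂ)ˣ) : Matrix (Fin 2) (Fin 2) ℂ).det = 1) (μ ν : ι) (x : S) :
    ((plaqU T U μ ν x : (Matrix (Fin 2) (Fin 2) ℂ)ˣ) : Matrix (Fin 2) (Fin 2) ℂ).det = 1 := by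
  rw [plaqU, Units.val_mul, Units.val_mul, Units.val_mul, Matrix.det_mul, Matrix.det_mul, Matrix.det_mul, hU, hU, det_val_inv_eq_one _ (hU _ _),
    det_val_inv_eq_one _ (hU _ _)]
  norm_num

/-- **`Π e^{iηA′ₖ}` OF A TRACELESS FIELD HAS DETERMINANT ONE** (`det e^{Y} = e^{tr Y}`, `tr R(U)X = tr X`). [cite: Balaban1985BackgroundPropagators, (3.3) p.390] -/
theorem det_val_holU_letters_eq_one (η : ℝ) (A : ι → S → Matrix (Fin 2) (Fin 2) ℂ) (hA : ∀ κ y, (A κ y).trace = 0) (μ ν : ι) (x : S) :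
    ((holU (letters η (lettersA T U A μ ν x)) : (Matrix (Fin 2) (Fin 2) ℂ)ˣ) : Matrix (Fin 2) (Fin 2) ℂ).det = 1 := by
  rw [val_holU]
  simp only [lettersA, letters, holonomy, List.map_cons, List.map_nil, List.prod_cons, List.prod_nil, Matrix.det_mul,
    Literature.Analysis.Matrix.det_exp_eq_exp_trace, Matrix.trace_smul, Matrix.trace_neg, trace_R, hA, neg_zero, smul_zero, NormedSpace.exp_zero,
    mul_one]

/-- **… HENCE `tr P⁻¹ = tr P` FOR `P = Π e^{iηA′ₖ}·U₀(∂p)`.** [cite: Balaban1985BackgroundPropagators, (3.7) p.391] -/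
theorem trace_inv_holU_mul_plaqU (hU : ∀ μ x, ((U μ x : (Matrix (Fin 2) (Fin 2) ℂ)ˣ) : Matrix (Fin 2) (Fin 2) ℂ).det = 1) (η : ℝ)
    (A : ι → S → Matrix (Fin 2) (Fin 2) ℂ) (hA : ∀ κ y, (A κ y).trace = 0) (μ ν : ι) (x : S) :
    ((((holU (letters η (lettersA T U A μ ν x)) * plaqU T U μ ν x)⁻¹ : (Matrix (Fin 2) (Fin 2) ℂ)ˣ)) : Matrix (Fin 2) (Fin 2) ℂ).trace
      = ((holU (letters η (lettersA T U A μ ν x)) * plaqU T U μ ν x : (Matrix (Fin 2) (Fin 2) ℂ)ˣ) : Matrix (Fin 2) (Fin 2) ℂ).trace :=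
  trace_inv_eq_trace_of_det_eq_one _ (by rw [Units.val_mul, Matrix.det_mul, det_val_holU_letters_eq_one T U η A hA, det_val_plaqU_eq_one T U hU, mul_one])

/-- `tr X = 0` for `X = η⁻¹ΣA′ₖ` of a traceless field. [cite: Balaban1985BackgroundPropagators, (3.4) p.391] -/
theorem trace_plaqD_lettersA_eq_zero (η : ℝ) (A : ι → S → Matrix (Fin 2) (Fin 2) ℂ) (hA : ∀ κ y, (A κ y).trace = 0) (μ ν : ι) (x : S) :
    (plaqD η (lettersA T U A μ ν x)).trace = 0 := by
  simp only [plaqD, lettersA, List.sum_cons, List.sum_nil, Matrix.trace_smul, Matrix.trace_add, Matrix.trace_neg, trace_R, hA,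
    neg_zero, add_zero, smul_zero]

variable [Fintype S] [Fintype ι] [LinearOrder ι] [DecidableEq S]

/-- ★★ **THE ONE-BOND FUNCTIONAL OF `V′₀` KILLS THE CENTRE ON `M₂(ℂ)`**: for the trace functional, a determinant-one reading `U₀` (e.g. `SU(2)`-valued) and a
traceless-valued field `A` (e.g. Hermitian traceless), `((∂/∂A(b))V′₀)(A, ∂q)·(c·1) = 0` for every plaquette `q`, bond `b = (μ₀, x₀)` and scalar `c` — the
`V′₀`-current of (90) is blind to the centre (one half of the row `hV0` of the EX display: with reality, the current is Hermitian-TRACELESS-valued).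
[cite: Balaban1985Variational, (90) p.291, (63) p.287, (39) p.284; Balaban1985BackgroundPropagators, (3.7) p.391] -/
theorem dV0primeBond_apply_smul_one_eq_zero (τ : Matrix (Fin 2) (Fin 2) ℂ →L[ℂ] ℂ) (hτ : ∀ X, τ X = X.trace)
    (hU : ∀ μ x, ((U μ x : (Matrix (Fin 2) (Fin 2) ℂ)ˣ) : Matrix (Fin 2) (Fin 2) ℂ).det = 1) (η : ℝ) (A : ι → S → Matrix (Fin 2) (Fin 2) ℂ)
    (hA : ∀ κ y, (A κ y).trace = 0) (q : S × ι × ι) (μ₀ : ι) (x₀ : S) (c : ℂ) :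
    dV0primeBond T U η τ A q μ₀ x₀ (c • (1 : Matrix (Fin 2) (Fin 2) ℂ)) = 0 :=
  dV0primeBond_apply_smul_one_eq_zero_of T U τ (fun a b => by rw [hτ, hτ, Matrix.trace_mul_comm]) η A q μ₀ x₀ c
    (by rw [hτ, hτ, trace_inv_holU_mul_plaqU T U hU η A hA])
    (by rw [hτ, trace_imC_eq_zero_of_det_eq_one _ (det_val_plaqU_eq_one T U hU _ _ _)])
    (by rw [hτ, trace_mul_reC_eq_zero_of_det_eq_one _ (det_val_plaqU_eq_one T U hU _ _ _) (trace_plaqD_lettersA_eq_zero T U η A hA _ _ _)])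

omit [LinearOrder ι] [DecidableEq S] in
/-- ★ **… AND SO DOES THE LINE DERIVATIVE `(d/ds)V′₀(A + s·d·1, ∂p)|₀`** along any central scalar field `d`. [cite: Balaban1985Variational, (39) p.284, (63) p.287] -/
theorem deriv_V0primeP_central_eq_zero_M2 (τ : Matrix (Fin 2) (Fin 2) ℂ →L[ℂ] ℂ) (hτ : ∀ X, τ X = X.trace)
    (hU : ∀ μ x, ((U μ x : (Matrix (Fin 2) (Fin 2) ℂ)ˣ) : Matrix (Fin 2) (Fin 2) ℂ).det = 1) (η : ℝ) (A : ι → S → Matrix (Fin 2) (Fin 2) ℂ)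
    (hA : ∀ κ y, (A κ y).trace = 0) (d : ι → S → ℂ) (μ ν : ι) (x : S) :
    deriv (fun s : ℂ => V0primeP T U η (τ : Matrix (Fin 2) (Fin 2) ℂ →ₗ[ℂ] ℂ) (A + s • fun κ y => d κ y • (1 : Matrix (Fin 2) (Fin 2) ℂ)) μ ν x) 0
      = 0 :=
  deriv_V0primeP_central_eq_zero T U τ (fun a b => by rw [hτ, hτ, Matrix.trace_mul_comm]) η A d μ ν x
    (by rw [hτ, hτ, trace_inv_holU_mul_plaqU T U hU η A hA])
    (by rw [hτ, trace_imC_eq_zero_of_det_eq_one _ (det_val_plaqU_eq_one T U hU _ _ _)])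
    (by rw [hτ, trace_mul_reC_eq_zero_of_det_eq_one _ (det_val_plaqU_eq_one T U hU _ _ _) (trace_plaqD_lettersA_eq_zero T U η A hA _ _ _)])

end M2

end Summit.QuantumFields.YangMills.Theorems.Prop7V0CurrentCentralDeriv

end
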